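import Literature.Geometry.Manifold.DeRhamComparison
import Literature.AlgebraicGeometry.HodgeTheory.ComplexifiedDeRhamFamily
import HarnessLib

/-!
# De Rham's theorem: the natural isomorphism family, and the discharge of `exists_complexDeRhamIsoFamily`

**de Rham's theorem** (de Rham 1931; Bredon (1993), Thm. V.9.5; Lee (2013), Thm. 18.14;
Warner (1983), 5.36 with 5.38), proved by integration over smooth singular simplices and
Bredon's bootstrap (`Literature.Geometry.Manifold.DeRhamBootstrap`, `…DeRhamComparison`):

* `integrationDeRhamIsoFamily E`: for the model `𝓘(ℝ, E)`, `E` finite-dimensional, the de Rham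
  isomorphism family `H^k_dR(M; ℝ) ≃ₗ[ℝ] Hᵏ(M; ℝ)` over all Hausdorff σ-compact `C^∞` manifolds
  charted on `E`, given by `[α] ↦ [σ ↦ ∫_σ α]`;
* `integrationDeRhamIsoFamily_isNatural`, `integrationDeRhamIsoFamily_isNormalized`: it is
  natural for `C^∞` maps and sends `[1]` to `1`;
* `exists_isNatural_deRhamIsoFamily`: hence a natural (and normalised) real de Rham isomorphism
  family exists;
* `exists_complexDeRhamIsoFamily_holds`: **discharge of the named fact
  `Literature.NumberTheory.Transcendental.exists_complexDeRhamIsoFamily`** (de Rham's theorem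
  with complex coefficients, natural in `C^∞` maps), by complexification
  (`DeRhamIsoFamily.complexify`, `…complexify_isNatural` of `ComplexifiedDeRhamFamily`).

* `integrationDeRhamIsoFamily_natural₂`, `integrationDeRhamIsoFamily_complexify_natural₂`
  (`homologyMap_pullbackUniv_comp_deRhamComparisonIso₂`): naturality of the (complexified)
  integration family for `C^∞` maps between manifolds charted on DIFFERENT model spaces `E`, `E'`
  (different dimensions) — not expressible by `IsNatural`, same proof.

The multiplicativity clause of the real fact `exists_deRhamIsoFamily` (wedge ↦ cup; Warner 5.45,
Bredon VI.? via acyclic models) is not addressed here.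

## References

* G. de Rham, *Sur l'analysis situs des variétés à n dimensions*, J. Math. Pures Appl. 10 (1931).
* G. E. Bredon, *Topology and Geometry*, GTM 139 (1993), Thm. V.9.5.
* J. M. Lee, *Introduction to Smooth Manifolds*, 2nd ed. (2013), Thm. 18.14.
* F. W. Warner, *Foundations of Differentiable Manifolds and Lie Groups* (1983), 5.36–5.38.
-/

noncomputable section

-- see "Implementation notes" in `…SingularHomology.SingularChainsConcrete`
set_option backward.isDefEq.respectTransparency false

open scoped Manifold ContDiff Topology
open CategoryTheory Limits Set Literature.AlgebraicTopology.SingularHomology Literature.Geometry.Kaehler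
  Literature.Geometry.Manifold

universe u

namespace Literature.NumberTheory.Transcendental

variable (E : Type u) [NormedAddCommGroup E] [NormedSpace ℝ E] [FiniteDimensional ℝ E]

/-! ### Topological preliminaries: σ-compact manifolds on `E` -/

section Topology

/-- A σ-compact manifold charted on a finite-dimensional space is second countable. [folklore] -/
theorem secondCountableTopology_of_sigmaCompact (M : Type u) [TopologicalSpace M] [ChartedSpace E M]
    [SigmaCompactSpace M] : SecondCountableTopology M :=
  ChartedSpace.secondCountable_of_sigmaCompact E M

/-- A manifold charted on a finite-dimensional space is locally compact. [folklore] -/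
theorem locallyCompactSpace_of_chartedSpace (M : Type u) [TopologicalSpace M] [ChartedSpace E M] :
    LocallyCompactSpace M :=
  ChartedSpace.locallyCompactSpace E M

end Topology

/-! ### The integration isomorphism family -/

/-- **The de Rham isomorphism family given by integration**: for every Hausdorff σ-compact
`C^∞` manifold `M` charted on `E` and every `k`, the composite
`H^k_dR(M; ℝ) ≃ Hᵏ(Ω•(univ)) ≅ Hᵏ(M; ℝ)` of `deRhamIsoLocal` and `deRhamComparisonIso`
(`[α] ↦ [σ ↦ ∫_σ α]` followed by the inverse of "restriction to smooth chains").
de Rham (1931); Bredon (1993), Thm. V.9.5; Lee (2013), Thm. 18.14. [cite: Bredon1993, Thm. V.9.5] -/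
def integrationDeRhamIsoFamily : DeRhamIsoFamily 𝓘(ℝ, E) := fun M _ _ _ _ _ k ↦
  haveI : SecondCountableTopology M := secondCountableTopology_of_sigmaCompact E M
  haveI : LocallyCompactSpace M := locallyCompactSpace_of_chartedSpace E M
  (deRhamIsoLocal 𝓘(ℝ, E) M ℝ k).trans (deRhamComparisonIso 𝓘(ℝ, E) M k).toLinearEquiv

variable {E}

/-- The integration family on a class, unfolded. [folklore] -/
theorem integrationDeRhamIsoFamily_apply (M : Type u) [TopologicalSpace M] [ChartedSpace E M]
    [IsManifold 𝓘(ℝ, E) ∞ M] [T2Space M] [SigmaCompactSpace M] (k : ℕ) (c : deRhamCohomology 𝓘(ℝ, E) M ℝ k) :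
    integrationDeRhamIsoFamily E M k c =
      haveI : SecondCountableTopology M := secondCountableTopology_of_sigmaCompact E M
      haveI : LocallyCompactSpace M := locallyCompactSpace_of_chartedSpace E M
      (deRhamComparisonIso 𝓘(ℝ, E) M k).hom (deRhamIsoLocal 𝓘(ℝ, E) M ℝ k c) :=
  rfl

/-! ### Naturality -/

section Naturality

variable {M N : Type u} [TopologicalSpace M] [ChartedSpace E M] [IsManifold 𝓘(ℝ, E) ∞ M] [T2Space M]
  [SecondCountableTopology M] [LocallyCompactSpace M]
  [TopologicalSpace N] [ChartedSpace E N] [IsManifold 𝓘(ℝ, E) ∞ N] [T2Space N]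
  [SecondCountableTopology N] [LocallyCompactSpace N]

/-- **Naturality of the comparison isomorphism** `Hᵏ(Ω•(univ)) ≅ Hᵏ(·; ℝ)` under `C^∞` maps:
`H(f^*) ≫ comparison_M = comparison_N ≫ f^*` (Lee (2013), Prop. 18.13; Bredon (1993), §V.9).
[cite: LeeSmoothManifolds2013, Thm. 18.14] -/
theorem homologyMap_pullbackUniv_comp_deRhamComparisonIso {f : M → N} (hf : ContMDiff 𝓘(ℝ, E) 𝓘(ℝ, E) ∞ f) (k : ℕ) :
    HomologicalComplex.homologyMap (localDeRhamComplex.pullbackUniv 𝓘(ℝ, E) hf) k ≫ (deRhamComparisonIso 𝓘(ℝ, E) M k).hom =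
      (deRhamComparisonIso 𝓘(ℝ, E) N k).hom ≫ singularCohomology.map ℝ ℝ ⟨f, hf.continuous⟩ k := by
  haveI := isIso_homologyMap_toSmoothAll (I := 𝓘(ℝ, E)) (M := M) k
  -- test against the isomorphism `H(singIso_M) ≫ H(toSmoothAll_M)`
  rw [← cancel_mono (HomologicalComplex.homologyMap (singIso M).hom k ≫ HomologicalComplex.homologyMap (toSmoothAll 𝓘(ℝ, E) M) k),
    Category.assoc, deRhamComparisonIso_hom_comp, ← HomologicalComplex.homologyMap_comp, pullbackUniv_comp_deRhamMap,
    HomologicalComplex.homologyMap_comp]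
  change _ = _ ≫ HomologicalComplex.homologyMap (singularCochainComplex.map ℝ ℝ ⟨f, hf.continuous⟩) k ≫ _ ≫ _
  rw [← HomologicalComplex.homologyMap_comp_assoc, singIso_hom_naturality, HomologicalComplex.homologyMap_comp_assoc,
    ← HomologicalComplex.homologyMap_comp (dualMap ℝ realCoeff (csingularChainComplex.map ℝ ℝ ⟨f, hf.continuous⟩))
      (toSmoothAll 𝓘(ℝ, E) M) k,
    ← toSmoothAll_naturality hf, HomologicalComplex.homologyMap_comp, deRhamComparisonIso_hom_comp_assoc]

end Naturality

/-- **The integration family is natural** for `C^∞` maps (Lee (2013), Prop. 18.13 / Thm. 18.14;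
Warner (1983), 5.38). [cite: LeeSmoothManifolds2013, Thm. 18.14] -/
theorem integrationDeRhamIsoFamily_isNatural : (integrationDeRhamIsoFamily E).IsNatural := by
  intro M N _ _ _ _ _ _ _ _ _ _ _ f hf k c
  haveI : SecondCountableTopology M := secondCountableTopology_of_sigmaCompact E M
  haveI : LocallyCompactSpace M := locallyCompactSpace_of_chartedSpace E M
  haveI : SecondCountableTopology N := secondCountableTopology_of_sigmaCompact E N
  haveI : LocallyCompactSpace N := locallyCompactSpace_of_chartedSpace E N
  rw [integrationDeRhamIsoFamily_apply, integrationDeRhamIsoFamily_apply]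
  change (deRhamComparisonIso 𝓘(ℝ, E) M k).hom (deRhamToLocal 𝓘(ℝ, E) M ℝ k (deRhamCohomology.map hf k c)) =
    singularCohomology.map ℝ ℝ ⟨f, hf.continuous⟩ k ((deRhamComparisonIso 𝓘(ℝ, E) N k).hom (deRhamToLocal 𝓘(ℝ, E) N ℝ k c))
  rw [deRhamToLocal_map, ← ModuleCat.comp_apply, ← ModuleCat.comp_apply,
    homologyMap_pullbackUniv_comp_deRhamComparisonIso hf k]

/-! ### Normalisation -/

section Normalisation

variable {M : Type u} [TopologicalSpace M] [ChartedSpace E M] [IsManifold 𝓘(ℝ, E) ∞ M] [T2Space M]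
  [SecondCountableTopology M] [LocallyCompactSpace M]

omit [FiniteDimensional ℝ E] [T2Space M] [SecondCountableTopology M] [LocallyCompactSpace M] in
/-- The unit of singular cohomology as a homology class of the unit cochain. [folklore] -/
theorem singularCohomology_one_eq_homologyCls :
    singularCohomology.one ℝ M =
      homologyCls (K := singularCochainComplex ℝ ℝ M) (cochainOne ℝ M)
        (by rw [(ComplexShape.up ℕ).next_eq' (rfl : 0 + 1 = 1)]; exact d_cochainOne ℝ) := by
  rw [homologyCls_eq_homologyπ_cyclesMk _ _ 1 ((ComplexShape.up ℕ).next_eq' (rfl : 0 + 1 = 1)) (d_cochainOne ℝ)]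
  rfl

omit [FiniteDimensional ℝ E] [T2Space M] [SecondCountableTopology M] [LocallyCompactSpace M] in
/-- **The de Rham homomorphism sends the constant function `1` to the unit cochain** restricted to
smooth chains: `∫_σ 1 = 1` for every (smooth) `0`-simplex. [cite: LeeSmoothManifolds2013, Thm. 18.14] -/
theorem deRhamMap_f_one_eq :
    (deRhamMap 𝓘(ℝ, E) (isOpen_univ : IsOpen (univ : Set M))).f 0
        (closedToUniv 𝓘(ℝ, E) M ℝ 0 ⟨MForm.const 𝓘(ℝ, E) M (1 : ℝ), const_mem_closedSmoothForms 1⟩) =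
      (toSmoothAll 𝓘(ℝ, E) M).f 0 ((singIso M).hom.f 0 (cochainOne ℝ M)) := by
  rw [dualMap_f_apply]
  refine ModuleCat.hom_ext (LinearMap.ext fun x ↦ ?_)
  obtain ⟨c, hc⟩ := x
  change CChain ℝ M 0 at c
  have hST : ∀ x : CChain ℝ M 0, x ∈ smoothChainsInSub 𝓘(ℝ, E) ℝ ℝ M univ 0 → ∀ σ ∈ x.support,
      Finsupp.single σ (x σ) ∈ smoothChainsInSub 𝓘(ℝ, E) ℝ ℝ M univ 0 := fun x hx σ hσ ↦
    single_mem_smoothChainsInSub ((mem_smoothChains_iff x).1 hx.1 σ hσ) (subset_univ _) _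
  rw [subcomplex_eq_sum_single (smoothChainsInSub 𝓘(ℝ, E) ℝ ℝ M univ) hST c hc, map_sum, map_sum]
  refine Finset.sum_congr rfl fun τ _ ↦ ULift.ext _ _ ?_
  change cochainVal ((deRhamMap 𝓘(ℝ, E) (isOpen_univ : IsOpen (univ : Set M))).f 0 _) _ =
    ((ModuleCat.Hom.hom ((singIso M).hom.f 0 (cochainOne ℝ M) : (csingularChainComplex ℝ ℝ M).X 0 ⟶ realCoeff))
      (Finsupp.single τ.1 (c τ.1))).down
  rw [deRhamMap_cochainVal, singIso_hom_f_apply_single, cochainOne_apply, mul_one]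
  change integrationFunctional (MForm.const 𝓘(ℝ, E) M (1 : ℝ)) (Finsupp.single τ.1 (c τ.1)) = c τ.1
  rw [integrationFunctional_single, SingularSimplex.formIntegral_eq_of_zero, MForm.const_apply, mul_one]

/-- **Normalisation**: the comparison isomorphism sends the class of the constant function `1`
to the unit of `H⁰(M; ℝ)`. [cite: LeeSmoothManifolds2013, Thm. 18.14] -/
theorem deRhamComparisonIso_hom_one :
    (deRhamComparisonIso 𝓘(ℝ, E) M 0).hom
        (deRhamIsoLocal 𝓘(ℝ, E) M ℝ 0 (deRhamCohomology.one 𝓘(ℝ, E) M ℝ)) = singularCohomology.one ℝ M := by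
  haveI := isIso_homologyMap_toSmoothAll (I := 𝓘(ℝ, E)) (M := M) 0
  -- test against the injective map `H(singIso) ≫ H(toSmoothAll)`
  have hinj : Function.Injective
      (HomologicalComplex.homologyMap (singIso M).hom 0 ≫ HomologicalComplex.homologyMap (toSmoothAll 𝓘(ℝ, E) M) 0) :=
    (ConcreteCategory.isIso_iff_bijective _).1 inferInstance |>.1
  apply hinj
  change ((deRhamComparisonIso 𝓘(ℝ, E) M 0).hom ≫ HomologicalComplex.homologyMap (singIso M).hom 0 ≫
      HomologicalComplex.homologyMap (toSmoothAll 𝓘(ℝ, E) M) 0)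
    (deRhamIsoLocal 𝓘(ℝ, E) M ℝ 0 (deRhamCohomology.mk ⟨MForm.const 𝓘(ℝ, E) M (1 : ℝ), const_mem_closedSmoothForms 1⟩)) = _
  rw [deRhamComparisonIso_hom_comp]
  rw [deRhamIsoLocal_mk, homologyMap_homologyCls, singularCohomology_one_eq_homologyCls, ModuleCat.comp_apply,
    homologyMap_homologyCls, homologyMap_homologyCls]
  exact homologyCls_congr deRhamMap_f_one_eq _ _

end Normalisation

/-- **The integration family is normalised**: `[1] ↦ 1`. [cite: LeeSmoothManifolds2013, Thm. 18.14] -/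
theorem integrationDeRhamIsoFamily_isNormalized : (integrationDeRhamIsoFamily E).IsNormalized := by
  intro M _ _ _ _ _
  haveI : SecondCountableTopology M := secondCountableTopology_of_sigmaCompact E M
  haveI : LocallyCompactSpace M := locallyCompactSpace_of_chartedSpace E M
  rw [integrationDeRhamIsoFamily_apply]
  exact deRhamComparisonIso_hom_one

/-! ### De Rham's theorem -/

variable (E) in
/-- **de Rham's theorem (natural, normalised form).** For a finite-dimensional real normed space
`E` there is a de Rham isomorphism family `H^k_dR(M; ℝ) ≃ₗ[ℝ] Hᵏ(M; ℝ)` over all Hausdorff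
σ-compact `C^∞` manifolds charted on `E` which is natural for `C^∞` maps and normalised — the
integration family. de Rham (1931); Bredon (1993), Thm. V.9.5; Lee (2013), Thm. 18.14; Warner
(1983), 5.36 with 5.38. [cite: Bredon1993, Thm. V.9.5] -/
theorem exists_isNatural_deRhamIsoFamily :
    ∃ e : DeRhamIsoFamily 𝓘(ℝ, E), e.IsNatural ∧ e.IsNormalized :=
  ⟨integrationDeRhamIsoFamily E, integrationDeRhamIsoFamily_isNatural, integrationDeRhamIsoFamily_isNormalized⟩

/-- **Discharge of the named fact `exists_complexDeRhamIsoFamily`** (de Rham's theorem with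
complex coefficients: a natural family `H^k_dR(M; ℂ) ≃ₗ[ℂ] Hᵏ(M; ℂ)` over the Hausdorff σ-compact
real-`C^∞` manifolds charted on the finite-dimensional complex normed space `E`): complexify the
natural real integration family (`DeRhamIsoFamily.complexify`, natural by
`DeRhamIsoFamily.complexify_isNatural`; Voisin (2002), §4.3.2 Rem. 4.48; Wells (1980),
Thm. III.4.13). [cite: WellsDACM1980, Thm. III.4.13] -/
theorem exists_complexDeRhamIsoFamily_holds (E : Type u) [NormedAddCommGroup E] [NormedSpace ℂ E]
    [FiniteDimensional ℂ E] : exists_complexDeRhamIsoFamily E := by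
  haveI : FiniteDimensional ℝ E := FiniteDimensional.complexToReal E
  exact ⟨(integrationDeRhamIsoFamily E).complexify,
    DeRhamIsoFamily.complexify_isNatural integrationDeRhamIsoFamily_isNatural⟩

/-- **What remains of the named fact `exists_deRhamIsoFamily`.** The integration family being
natural (`integrationDeRhamIsoFamily_isNatural`) and normalised
(`integrationDeRhamIsoFamily_isNormalized`), de Rham's theorem in the tree's multiplicative form
`exists_deRhamIsoFamily 𝓘(ℝ, E)` follows from the MULTIPLICATIVITY of the integration family alone
(`[α ∧ β] ↦ [α] ⌣ [β]` under `α ↦ (σ ↦ ∫_σ α)`: Warner (1983), Thm. 5.45; Bredon (1993), Thm. V.9.5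
with §VI.4; Bott–Tu (1982), Thm. 14.28) — the exact residual content of that fact (and, through
`cupPreservesHodgeType_of_exists_deRhamIsoFamily`, of "the cup product preserves Hodge types"),
kept as an explicit hypothesis rather than a further named fact (D-0026). [cite: WarnerGTM94, Thm. 5.45] -/
theorem exists_deRhamIsoFamily_of_isMultiplicative
    (hm : (integrationDeRhamIsoFamily E).IsMultiplicative) : exists_deRhamIsoFamily 𝓘(ℝ, E) :=
  ⟨integrationDeRhamIsoFamily E, integrationDeRhamIsoFamily_isNatural, hm,
    integrationDeRhamIsoFamily_isNormalized⟩

/-! ### Naturality ACROSS model spaces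

`DeRhamIsoFamily.IsNatural` / `ComplexDeRhamIsoFamily.IsNatural` quantify over `C^∞` maps between
manifolds charted on ONE model space `E`. The integration family is a single construction for all
manifolds, and its naturality holds for `C^∞` maps `f : M → N` with `M` charted on `E` and `N` on `E'`
(e.g. manifolds of different dimensions): the ingredients `toSmoothAll_naturality`,
`pullbackUniv_comp_deRhamMap`, `singIso_hom_naturality`, `deRhamToLocal_map` are already stated in that
generality. This is the functoriality of de Rham's theorem used to compare varieties of different
dimensions (pull-back along arbitrary morphisms). -/

section CrossModel

variable {E' : Type u} [NormedAddCommGroup E'] [NormedSpace ℝ E'] [FiniteDimensional ℝ E']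
  {M : Type u} [TopologicalSpace M] [ChartedSpace E M] [IsManifold 𝓘(ℝ, E) ∞ M] [T2Space M]
  {N : Type u} [TopologicalSpace N] [ChartedSpace E' N] [IsManifold 𝓘(ℝ, E') ∞ N] [T2Space N]

/-- **Naturality of the comparison isomorphism across model spaces**: for a `C^∞` map `f : M → N`,
`M` charted on `E` and `N` on `E'`, `H(f^*) ≫ comparison_M = comparison_N ≫ f^*`
(Lee (2013), Prop. 18.13 / Thm. 18.14; Bredon (1993), §V.9 — the same proof as
`homologyMap_pullbackUniv_comp_deRhamComparisonIso`). [cite: LeeSmoothManifolds2013, Thm. 18.14] -/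
theorem homologyMap_pullbackUniv_comp_deRhamComparisonIso₂ [SecondCountableTopology M]
    [LocallyCompactSpace M] [SecondCountableTopology N] [LocallyCompactSpace N]
    {f : M → N} (hf : ContMDiff 𝓘(ℝ, E) 𝓘(ℝ, E') ∞ f) (k : ℕ) :
    HomologicalComplex.homologyMap (localDeRhamComplex.pullbackUniv 𝓘(ℝ, E) hf) k ≫
        (deRhamComparisonIso 𝓘(ℝ, E) M k).hom =
      (deRhamComparisonIso 𝓘(ℝ, E') N k).hom ≫ singularCohomology.map ℝ ℝ ⟨f, hf.continuous⟩ k := by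
  haveI := isIso_homologyMap_toSmoothAll (I := 𝓘(ℝ, E)) (M := M) k
  -- test against the isomorphism `H(singIso_M) ≫ H(toSmoothAll_M)`
  rw [← cancel_mono (HomologicalComplex.homologyMap (singIso M).hom k ≫
      HomologicalComplex.homologyMap (toSmoothAll 𝓘(ℝ, E) M) k),
    Category.assoc, deRhamComparisonIso_hom_comp, ← HomologicalComplex.homologyMap_comp,
    pullbackUniv_comp_deRhamMap, HomologicalComplex.homologyMap_comp]
  change _ = _ ≫ HomologicalComplex.homologyMap (singularCochainComplex.map ℝ ℝ ⟨f, hf.continuous⟩) k ≫ _ ≫ _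
  rw [← HomologicalComplex.homologyMap_comp_assoc, singIso_hom_naturality,
    HomologicalComplex.homologyMap_comp_assoc,
    ← HomologicalComplex.homologyMap_comp (dualMap ℝ realCoeff (csingularChainComplex.map ℝ ℝ ⟨f, hf.continuous⟩))
      (toSmoothAll 𝓘(ℝ, E) M) k,
    ← toSmoothAll_naturality hf, HomologicalComplex.homologyMap_comp, deRhamComparisonIso_hom_comp_assoc]

/-- **The integration family is natural across model spaces**: for a `C^∞` map `f : M → N` between
Hausdorff σ-compact manifolds charted on the finite-dimensional `E`, `E'`,
`∫-iso_M (f^* c) = f^* (∫-iso_N c)` (Lee (2013), Thm. 18.14; Warner (1983), 5.38). With `E' = E` this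
is `integrationDeRhamIsoFamily_isNatural`. [cite: LeeSmoothManifolds2013, Thm. 18.14] -/
theorem integrationDeRhamIsoFamily_natural₂ [SigmaCompactSpace M] [SigmaCompactSpace N]
    [PullbackFacts 𝓘(ℝ, E) M 𝓘(ℝ, E') N ℝ]
    {f : M → N} (hf : ContMDiff 𝓘(ℝ, E) 𝓘(ℝ, E') ∞ f) (k : ℕ) (c : deRhamCohomology 𝓘(ℝ, E') N ℝ k) :
    integrationDeRhamIsoFamily E M k (deRhamCohomology.map hf k c) =
      singularCohomology.map ℝ ℝ ⟨f, hf.continuous⟩ k (integrationDeRhamIsoFamily E' N k c) := by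
  haveI : SecondCountableTopology M := secondCountableTopology_of_sigmaCompact E M
  haveI : LocallyCompactSpace M := locallyCompactSpace_of_chartedSpace E M
  haveI : SecondCountableTopology N := secondCountableTopology_of_sigmaCompact E' N
  haveI : LocallyCompactSpace N := locallyCompactSpace_of_chartedSpace E' N
  rw [integrationDeRhamIsoFamily_apply, integrationDeRhamIsoFamily_apply]
  change (deRhamComparisonIso 𝓘(ℝ, E) M k).hom (deRhamToLocal 𝓘(ℝ, E) M ℝ k (deRhamCohomology.map hf k c)) =
    singularCohomology.map ℝ ℝ ⟨f, hf.continuous⟩ k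
      ((deRhamComparisonIso 𝓘(ℝ, E') N k).hom (deRhamToLocal 𝓘(ℝ, E') N ℝ k c))
  rw [deRhamToLocal_map, ← ModuleCat.comp_apply, ← ModuleCat.comp_apply,
    homologyMap_pullbackUniv_comp_deRhamComparisonIso₂ hf k]

end CrossModel

/-- **The complexified integration family is natural across model spaces**: for complex
finite-dimensional model spaces `E`, `E'` and a real-`C^∞` map `f : M → N` (`M` charted on `E`, `N` on
`E'`), `(∫ ⊗ ℂ)_M (f^* c) = f^* ((∫ ⊗ ℂ)_N c)` on complex de Rham classes (`re`, `im`, `⊗ 1` commute with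
`f^*`: `complexDeRhamCohomology.re_map`, `im_map`, `ofRealClass_map`; and
`integrationDeRhamIsoFamily_natural₂`). This is the naturality of the reference complex de Rham
families `(integrationDeRhamIsoFamily E).complexify` of `exists_complexDeRhamIsoFamily_holds` along maps
between complex manifolds of DIFFERENT dimensions. [cite: VoisinHodgeI2002, §4.3.2 Rem. 4.48] -/
theorem integrationDeRhamIsoFamily_complexify_natural₂
    {E : Type u} [NormedAddCommGroup E] [NormedSpace ℂ E] [FiniteDimensional ℂ E]
    {E' : Type u} [NormedAddCommGroup E'] [NormedSpace ℂ E'] [FiniteDimensional ℂ E']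
    {M : Type u} [TopologicalSpace M] [ChartedSpace E M] [IsManifold 𝓘(ℝ, E) ∞ M] [T2Space M]
    [SigmaCompactSpace M]
    {N : Type u} [TopologicalSpace N] [ChartedSpace E' N] [IsManifold 𝓘(ℝ, E') ∞ N] [T2Space N]
    [SigmaCompactSpace N] [PullbackFacts 𝓘(ℝ, E) M 𝓘(ℝ, E') N ℂ]
    {f : M → N} (hf : ContMDiff 𝓘(ℝ, E) 𝓘(ℝ, E') ∞ f) (k : ℕ) (c : complexDeRhamCohomology E' N k) :
    haveI : FiniteDimensional ℝ E := FiniteDimensional.complexToReal E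
    haveI : FiniteDimensional ℝ E' := FiniteDimensional.complexToReal E'
    (integrationDeRhamIsoFamily E).complexify M k (complexDeRhamCohomology.map E hf k c) =
      singularCohomology.map ℂ ℂ ⟨f, hf.continuous⟩ k ((integrationDeRhamIsoFamily E').complexify N k c) := by
  haveI : FiniteDimensional ℝ E := FiniteDimensional.complexToReal E
  haveI : FiniteDimensional ℝ E' := FiniteDimensional.complexToReal E'
  haveI : PullbackFacts 𝓘(ℝ, E) M 𝓘(ℝ, E') N ℝ := PullbackFacts.real_of_complex
  rw [Literature.AlgebraicGeometry.HodgeTheory.complexify_apply,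
    Literature.AlgebraicGeometry.HodgeTheory.complexify_apply,
    Literature.AlgebraicGeometry.HodgeTheory.complexifyFun, complexDeRhamCohomology.re_map,
    complexDeRhamCohomology.im_map, integrationDeRhamIsoFamily_natural₂ hf k,
    integrationDeRhamIsoFamily_natural₂ hf k,
    Literature.AlgebraicGeometry.HodgeTheory.ofRealClass_map,
    Literature.AlgebraicGeometry.HodgeTheory.ofRealClass_map,
    Literature.AlgebraicGeometry.HodgeTheory.complexifyFun, map_add, map_smul]

end Literature.NumberTheory.Transcendental
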